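import Mathlib
import Summits.CriticalPhenomena.CardyFormulaZ2.Theorems.CardyFlipRussoSquareFromVoronoiHubDecimationDefs
import Literature.Probability.Percolation.SitePaths
import HarnessLib

/-!
# Centre decimation, events `⇒` — stub `stub_decimateForward` of line `centre-decimation`
# for crux `SquareFromVoronoiHub` (stmt-CriticalPhenomena-6434, route CardyFlipRusso, sub-problem CardyFormulaZ2)

We prove the forward half of the centre-decimation identity (CD) on the level of EVENTS (pure
combinatorics, no measure theory): if `ω ∈ gsConn A B U V`, i.e. some `u ∈ U`, `v ∈ V ⊆ ℤ²` are
joined by an open path of the centred square lattice `G_s` inside the window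
`Sum.inl '' A ∪ Sum.inr '' B`, then the relabelled configuration `decimate A ω = (ζ, σ)`
(`σ` = site colours, `ζ` = diagonal orientations, the centre coin flipped on the anti-diagonal
faces `antiDiagFaces A ω`) lies in the random-diagonal connection event `diagConn A B U V`.

Proof: turn the connection into a `PathIn` (`mem_siteConnIn_iff_pathIn`) and induct along it,
carrying the invariant "the current site (resp. some corner of the current face centre) is joined
to `u` by a `σ`-open path of `diagGraph B ζ` inside `A`".  A site–site step of `G_s` is a
nearest-neighbour edge of `diagGraph`; a site–centre step records the corner; a centre–site step
is closed by `corner_path`: two open corners of an admitted face with open centre are joined in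
`diagGraph B ζ` — equal, adjacent along a side, through a third open corner, or (when the open
corners inside `A` are exactly a diagonal pair) by the diagonal that the decimation rule puts
there.  Centre–centre steps do not exist.  (Rolla, arXiv:1704.04930, §1; Beffara 2008, §5.1.)
-/

noncomputable section
open scoped Topology MeasureTheory
open Filter Set MeasureTheory
open Literature.Probability.RandomPlanarGeometry (ConformalRectangle)
open Literature.Probability.Percolation (SiteConfig sitePercolation siteConnIn siteOpenGraph half
  centredSquareGraph centredSquareEmbedding)
open Summit.CriticalPhenomena.CardyFormulaZ2.Cruxes.SquareFromVoronoiHub.VoronoiBlocks (zGs Gs crudeCrossing)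

namespace Summit.CriticalPhenomena.CardyFormulaZ2.Cruxes.SquareFromVoronoiHub.CentreDecimation

namespace stub_decimateForwardAux

open Literature.Probability.Percolation

/-! ### The window `Sum.inl '' A ∪ Sum.inr '' B` -/

/-- A site `inl y` lies in the window iff `y ∈ A`. [folklore] -/
theorem inl_mem_window_iff {A B : Set (ℤ × ℤ)} {y : ℤ × ℤ} :
    (Sum.inl y : (ℤ × ℤ) ⊕ (ℤ × ℤ)) ∈ Sum.inl '' A ∪ Sum.inr '' B ↔ y ∈ A := by
  simp

/-- A centre `inr f` lies in the window iff `f ∈ B`. [folklore] -/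
theorem inr_mem_window_iff {A B : Set (ℤ × ℤ)} {f : ℤ × ℤ} :
    (Sum.inr f : (ℤ × ℤ) ⊕ (ℤ × ℤ)) ∈ Sum.inl '' A ∪ Sum.inr '' B ↔ f ∈ B := by
  simp

/-! ### Edges of the random-diagonal lattice `diagGraph B ζ` -/

/-- Adjacency in `diagGraph B ζ`, unfolded (`SimpleGraph.fromRel_adj`). [folklore] -/
theorem diagGraph_adj_iff (B ζ : Set (ℤ × ℤ)) (x y : ℤ × ℤ) :
    (diagGraph B ζ).Adj x y ↔ x ≠ y ∧
      ((y = (x.1 + 1, x.2) ∨ y = (x.1, x.2 + 1) ∨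
          (x ∈ B ∧ x ∈ ζ ∧ y = (x.1 + 1, x.2 + 1)) ∨
          ((x.1, x.2 - 1) ∈ B ∧ (x.1, x.2 - 1) ∉ ζ ∧ y = (x.1 + 1, x.2 - 1))) ∨
        (x = (y.1 + 1, y.2) ∨ x = (y.1, y.2 + 1) ∨
          (y ∈ B ∧ y ∈ ζ ∧ x = (y.1 + 1, y.2 + 1)) ∨
          ((y.1, y.2 - 1) ∈ B ∧ (y.1, y.2 - 1) ∉ ζ ∧ x = (y.1 + 1, y.2 - 1)))) :=
  SimpleGraph.fromRel_adj _ x y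

/-- The horizontal edges `x — x + e₁` of `ℤ²` are edges of `diagGraph B ζ`. [folklore] -/
theorem adj_right (B ζ : Set (ℤ × ℤ)) (x : ℤ × ℤ) : (diagGraph B ζ).Adj x (x.1 + 1, x.2) := by
  rw [diagGraph_adj_iff]
  exact ⟨fun h => by simp [Prod.ext_iff] at h, Or.inl (Or.inl rfl)⟩

/-- The vertical edges `x — x + e₂` of `ℤ²` are edges of `diagGraph B ζ`. [folklore] -/
theorem adj_up (B ζ : Set (ℤ × ℤ)) (x : ℤ × ℤ) : (diagGraph B ζ).Adj x (x.1, x.2 + 1) := by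
  rw [diagGraph_adj_iff]
  exact ⟨fun h => by simp [Prod.ext_iff] at h, Or.inl (Or.inr (Or.inl rfl))⟩

/-- The SW–NE diagonal `f — f + (1,1)` of an admitted face `f ∈ B` with `f ∈ ζ`. [folklore] -/
theorem adj_diag {B ζ : Set (ℤ × ℤ)} {f : ℤ × ℤ} (hB : f ∈ B) (hζ : f ∈ ζ) :
    (diagGraph B ζ).Adj f (f.1 + 1, f.2 + 1) := by
  rw [diagGraph_adj_iff]
  exact ⟨fun h => by simp [Prod.ext_iff] at h, Or.inl (Or.inr (Or.inr (Or.inl ⟨hB, hζ, rfl⟩)))⟩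

/-- The SE–NW diagonal `f + (0,1) — f + (1,0)` of an admitted face `f ∈ B` with `f ∉ ζ`.
[folklore] -/
theorem adj_antidiag {B ζ : Set (ℤ × ℤ)} {f : ℤ × ℤ} (hB : f ∈ B) (hζ : f ∉ ζ) :
    (diagGraph B ζ).Adj (f.1, f.2 + 1) (f.1 + 1, f.2) := by
  rw [diagGraph_adj_iff]
  refine ⟨fun h => by simp [Prod.ext_iff] at h, Or.inl (Or.inr (Or.inr (Or.inr ⟨?_, ?_, ?_⟩)))⟩
  · simpa using hB
  · simpa using hζ
  · simp

/-! ### Edges of `G_s` -/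

/-- A site–site edge of `G_s` is a nearest-neighbour edge of `ℤ²`, hence an edge of every
`diagGraph B ζ`. [folklore] -/
theorem gs_adj_inl_inl {x y : ℤ × ℤ} (h : Gs.Adj (Sum.inl x) (Sum.inl y)) (B ζ : Set (ℤ × ℤ)) :
    (diagGraph B ζ).Adj x y := by
  rw [Gs_eq_centredSquareGraph, centredSquareGraph_adj_iff] at h
  obtain ⟨-, ⟨x', hx', h⟩ | ⟨y', hy', h⟩⟩ := h
  · obtain rfl : x = x' := Sum.inl_injective hx'
    rcases h with h | h | ⟨g, hg, -⟩
    · obtain rfl := Sum.inl_injective h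
      exact adj_right B ζ x
    · obtain rfl := Sum.inl_injective h
      exact adj_up B ζ x
    · exact absurd hg Sum.inl_ne_inr
  · obtain rfl : y = y' := Sum.inl_injective hy'
    rcases h with h | h | ⟨g, hg, -⟩
    · obtain rfl := Sum.inl_injective h
      exact (adj_right B ζ y).symm
    · obtain rfl := Sum.inl_injective h
      exact (adj_up B ζ y).symm
    · exact absurd hg Sum.inl_ne_inr

/-- A site adjacent in `G_s` to a face centre is a corner of that face. [folklore] -/
theorem gs_adj_inl_inr {x g : ℤ × ℤ} (h : Gs.Adj (Sum.inl x) (Sum.inr g)) :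
    (x.1 = g.1 ∨ x.1 = g.1 + 1) ∧ (x.2 = g.2 ∨ x.2 = g.2 + 1) := by
  rwa [Gs_eq_centredSquareGraph, centredSquareGraph_adj_inl_inr_iff] at h

/-- A face centre is adjacent in `G_s` only to the corners of its face. [folklore] -/
theorem gs_adj_inr_inl {f y : ℤ × ℤ} (h : Gs.Adj (Sum.inr f) (Sum.inl y)) :
    (y.1 = f.1 ∨ y.1 = f.1 + 1) ∧ (y.2 = f.2 ∨ y.2 = f.2 + 1) :=
  gs_adj_inl_inr h.symm

/-- `G_s` has no centre–centre edges. [folklore] -/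
theorem not_gs_adj_inr_inr {f g : ℤ × ℤ} : ¬ Gs.Adj (Sum.inr f) (Sum.inr g) := by
  rw [Gs_eq_centredSquareGraph]
  exact not_centredSquareGraph_adj_inr_inr f g

/-! ### Corner-to-corner paths through a face with open centre -/

/-- **Diagonal pair, SW–NE.**  If the SW corner `f` and the NE corner `f + (1,1)` of an admitted
face with open centre are open sites of `A`, then `f` is not an anti-diagonal face, so the
decimated orientation is `f ∈ ζ` and the SW–NE diagonal joins the two corners. [folklore] -/
theorem diag_path {A B : Set (ℤ × ℤ)} {ω : SiteConfig ((ℤ × ℤ) ⊕ (ℤ × ℤ))} {f : ℤ × ℤ}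
    (hB : f ∈ B) (hω : Sum.inr f ∈ ω)
    (h00 : f ∈ A ∩ (decimate A ω).2) (h11 : (f.1 + 1, f.2 + 1) ∈ A ∩ (decimate A ω).2) :
    PathIn (diagGraph B (decimate A ω).1) (A ∩ (decimate A ω).2) f (f.1 + 1, f.2 + 1) := by
  refine PathIn.of_adj h00 h11 (adj_diag hB ?_)
  show Sum.inr f ∈ ω ↔ f ∉ antiDiagFaces A ω
  exact iff_of_true hω fun h => h.2.2.1 h00

/-- **Diagonal pair, SE–NW.**  If the NW corner `f + (0,1)` and the SE corner `f + (1,0)` of an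
admitted face with open centre are open sites of `A`, they are joined inside `A`: through the SW
or the NE corner if one of them is an open site of `A`, and otherwise `f` is an anti-diagonal
face, the decimated orientation is `f ∉ ζ`, and the SE–NW diagonal joins them. [folklore] -/
theorem antidiag_path {A B : Set (ℤ × ℤ)} {ω : SiteConfig ((ℤ × ℤ) ⊕ (ℤ × ℤ))} {f : ℤ × ℤ}
    (hB : f ∈ B) (hω : Sum.inr f ∈ ω)
    (h01 : (f.1, f.2 + 1) ∈ A ∩ (decimate A ω).2) (h10 : (f.1 + 1, f.2) ∈ A ∩ (decimate A ω).2) :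
    PathIn (diagGraph B (decimate A ω).1) (A ∩ (decimate A ω).2) (f.1, f.2 + 1) (f.1 + 1, f.2) := by
  by_cases h00 : f ∈ A ∩ (decimate A ω).2
  · exact (PathIn.of_adj h01 h00 (adj_up B _ f).symm).tail (adj_right B _ f) h10
  by_cases h11 : (f.1 + 1, f.2 + 1) ∈ A ∩ (decimate A ω).2
  · exact (PathIn.of_adj h01 h11 (adj_right B _ (f.1, f.2 + 1))).tail
      (adj_up B _ (f.1 + 1, f.2)).symm h10
  have hanti : f ∈ antiDiagFaces A ω := ⟨h10, h01, h00, h11⟩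
  refine PathIn.of_adj h01 h10 (adj_antidiag hB fun hζ => ?_)
  exact (show Sum.inr f ∈ ω ↔ f ∉ antiDiagFaces A ω from hζ).mp hω hanti

/-- **Corner to corner.**  Two open corners (sites of `A`) of an admitted face with open centre
are joined by an open path of `diagGraph B ζ` inside `A` (sixteen cases: equal, a side of the
face, or one of the two diagonal pairs). [folklore] -/
theorem corner_path {A B : Set (ℤ × ℤ)} {ω : SiteConfig ((ℤ × ℤ) ⊕ (ℤ × ℤ))} {f : ℤ × ℤ}
    {x1 x2 y1 y2 : ℤ} (hB : f ∈ B) (hω : Sum.inr f ∈ ω)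
    (hx : (x1 = f.1 ∨ x1 = f.1 + 1) ∧ (x2 = f.2 ∨ x2 = f.2 + 1))
    (hy : (y1 = f.1 ∨ y1 = f.1 + 1) ∧ (y2 = f.2 ∨ y2 = f.2 + 1))
    (hxT : (x1, x2) ∈ A ∩ (decimate A ω).2) (hyT : (y1, y2) ∈ A ∩ (decimate A ω).2) :
    PathIn (diagGraph B (decimate A ω).1) (A ∩ (decimate A ω).2) (x1, x2) (y1, y2) := by
  obtain ⟨rfl | rfl, rfl | rfl⟩ := hx <;> obtain ⟨rfl | rfl, rfl | rfl⟩ := hy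
  all_goals first
    | exact PathIn.refl hxT
    | exact PathIn.of_adj hxT hyT (adj_right B _ (f.1, f.2))
    | exact PathIn.of_adj hxT hyT (adj_right B _ (f.1, f.2 + 1))
    | exact PathIn.of_adj hxT hyT (adj_up B _ (f.1, f.2))
    | exact PathIn.of_adj hxT hyT (adj_up B _ (f.1 + 1, f.2))
    | exact PathIn.of_adj hxT hyT (adj_right B _ (f.1, f.2)).symm
    | exact PathIn.of_adj hxT hyT (adj_right B _ (f.1, f.2 + 1)).symm
    | exact PathIn.of_adj hxT hyT (adj_up B _ (f.1, f.2)).symm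
    | exact PathIn.of_adj hxT hyT (adj_up B _ (f.1 + 1, f.2)).symm
    | exact diag_path hB hω hxT hyT
    | exact (diag_path hB hω hyT hxT).symm
    | exact antidiag_path hB hω hxT hyT
    | exact (antidiag_path hB hω hyT hxT).symm

/-! ### The induction along an open `G_s`-path -/

/-- **Decimating an open `G_s`-path.**  An open `G_s`-path inside the window from `inl u` to
`inl v` yields a `σ`-open path of `diagGraph B ζ` inside `A` from `u` to `v`, where
`(ζ, σ) = decimate A ω`.  Induction along the path with the invariant: the current site, resp.
some corner of the current face centre, is so joined to `u`. [folklore] -/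
theorem pathIn_decimate {A B : Set (ℤ × ℤ)} {ω : SiteConfig ((ℤ × ℤ) ⊕ (ℤ × ℤ))} {u v : ℤ × ℤ}
    (h : PathIn Gs ((Sum.inl '' A ∪ Sum.inr '' B) ∩ ω) (Sum.inl u) (Sum.inl v)) :
    PathIn (diagGraph B (decimate A ω).1) (A ∩ (decimate A ω).2) u v := by
  obtain ⟨hu, h⟩ := h
  suffices key : ∀ c,
      Relation.ReflTransGen (fun a b => Gs.Adj a b ∧ b ∈ (Sum.inl '' A ∪ Sum.inr '' B) ∩ ω)
        (Sum.inl u) c →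
      (∀ y, c = Sum.inl y → PathIn (diagGraph B (decimate A ω).1) (A ∩ (decimate A ω).2) u y) ∧
      (∀ g, c = Sum.inr g → ∃ x : ℤ × ℤ, ((x.1 = g.1 ∨ x.1 = g.1 + 1) ∧ (x.2 = g.2 ∨ x.2 = g.2 + 1)) ∧
        PathIn (diagGraph B (decimate A ω).1) (A ∩ (decimate A ω).2) u x) from
    (key _ h).1 v rfl
  intro c hc
  induction hc with
  | refl =>
    refine ⟨fun y hy => ?_, fun g hg => absurd hg Sum.inl_ne_inr⟩
    obtain rfl : u = y := Sum.inl_injective hy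
    exact PathIn.refl ⟨inl_mem_window_iff.mp hu.1, hu.2⟩
  | @tail b c hub hbc ih =>
    have hbP : PathIn Gs ((Sum.inl '' A ∪ Sum.inr '' B) ∩ ω) (Sum.inl u) b := ⟨hu, hub⟩
    have hb : b ∈ (Sum.inl '' A ∪ Sum.inr '' B) ∩ ω := hbP.right_mem
    obtain ⟨hadj, hcS⟩ := hbc
    refine ⟨fun y hy => ?_, fun g hg => ?_⟩
    · subst hy
      have hyT : y ∈ A ∩ (decimate A ω).2 := ⟨inl_mem_window_iff.mp hcS.1, hcS.2⟩
      cases b with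
      | inl x => exact (ih.1 x rfl).tail (gs_adj_inl_inl hadj B _) hyT
      | inr f =>
        obtain ⟨x, hxf, hpx⟩ := ih.2 f rfl
        exact hpx.trans (corner_path (inr_mem_window_iff.mp hb.1) hb.2 hxf (gs_adj_inr_inl hadj)
          hpx.right_mem hyT)
    · subst hg
      cases b with
      | inl x => exact ⟨x, gs_adj_inl_inr hadj, ih.1 x rfl⟩
      | inr f => exact absurd hadj not_gs_adj_inr_inr

end stub_decimateForwardAux

/-- **stub_decimateForward** (CD, events, `⇒`): an open `G_s` connection from `inl u` to `inl v`
inside the window `inl '' A ∪ inr '' B` becomes, under `decimate A`, an open random-diagonal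
connection from `u` to `v` inside `A` with diagonals admitted in `B` (each visit of a centre is
replaced by a corner detour or by the diagonal the relabelled coin provides). -/
theorem stub_decimateForward :
    ∀ (A B U V : Set (ℤ × ℤ)) (ω : SiteConfig ((ℤ × ℤ) ⊕ (ℤ × ℤ))),
      ω ∈ gsConn A B U V → decimate A ω ∈ diagConn A B U V := by
  rintro A B U V ω ⟨u, hu, v, hv, h⟩
  exact ⟨u, hu, v, hv, Literature.Probability.Percolation.mem_siteConnIn_iff_pathIn.2
    (stub_decimateForwardAux.pathIn_decimate
      (Literature.Probability.Percolation.mem_siteConnIn_iff_pathIn.1 h))⟩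

end Summit.CriticalPhenomena.CardyFormulaZ2.Cruxes.SquareFromVoronoiHub.CentreDecimation
end
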